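import Literature.Analysis.InnerProduct.SecularExcessRayleigh
import Summits.RiemannHypothesis.RiemannHypothesis.Theorems.PfPersistenceIntruderArrival
import Summits.RiemannHypothesis.RiemannHypothesis.Theorems.PfPersistenceIntruderArrivalMulti
import HarnessLib

/-!
# PF-persistence THEORY 3 (gen 7) — the MULTI-DRIVER ARRIVAL LAW in RAYLEIGH form, read on a split
# `T = B − ∑ᵢ |vᵢ⟩⟨vᵢ|` (publication cell `pub-rhpf`, theory seat 3)

Framing (page 1 of every `pub-rhpf` file): **mechanism/rigidity campaign — nothing here is a claim
about RH.** Everything in this file is PROVED abstract linear algebra; no statement about `ζ` or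
about any control family is made; every empirical sentence in the docstrings is labelled DATA and
refers to `run/shared/lean/pub/pub-rhpf/pub-rhpf-theory-3/THEORY-INTRUDER.md` §12.

Setting (continuing `PfPersistenceIntruderArrivalMulti`, whose `inner_vec_self` / `sum_sq_moment_eq`
and `PfPersistenceIntruderArrival`'s `Intruder.vec_ne_zero` are reused): `E` a real inner product
space (the even cosine sector of a windowed form), `T : E →ₗ[ℝ] E` the window's Galerkin operator,
`S : OffLineSplitN T ι` a split `T = B − ∑ᵢ |vᵢ⟩⟨vᵢ|` with `B ≥ 0`, `I : Intruder T` a unit eigenvector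
`u` with eigenvalue `I.eig = −|ε| < 0`, `z : ι → E` witnesses `B zᵢ = vᵢ`, `cᵢ := ⟪vᵢ, u⟫` the moment
vector, `|c|² = ∑ᵢ cᵢ²`, `M = (⟪vᵢ, zⱼ⟫) = VᵀB⁻¹V` the capacitance matrix, `Ex(c) = cᵀ(M − I)c` its
excess form and `r := cᵀMc/|c|²` the RAYLEIGH QUOTIENT of `M` at the moment vector (well defined:
`sum_sq_moment_pos`, `|c|² = ⟪Bu,u⟫ + |ε| > 0`). Gen 6 part 2 proved `|ε| ≤ Ex(c) ≤ |ε|‖B⁻¹Vc‖²`;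
the tree file `Literature/Analysis/InnerProduct/SecularExcessRayleigh.lean` gives, read on the split:

* `negEig_mul_sq_moment_le_excess_mul_form` — `|ε| |c|² ≤ Ex(c) ⟪B u, u⟫`, i.e.
  `|ε| ≤ (r − 1)⟪Bu,u⟫` (PSD Cauchy–Schwarz; no norm bound on `B` needed);
* `negEig_mul_sq_moment_le_mul_excess` — `B ≤ Λ ⇒ |ε| |c|² ≤ Λ Ex(c)`, i.e. `|ε| ≤ ‖B‖(r − 1)`;
* `mul_excess_le_negEig_mul_sq_moment` — `0 ≤ β ≤ B ⇒ β Ex(c) ≤ |ε| |c|²`, i.e.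
  `λ_min(B)(r − 1) ≤ |ε|`;
* `rayleigh_two_sided` — both at once.

Reading (PROVED): with several drivers on, EACH negative eigenvalue of the window satisfies
`λ_min(B)·(r − 1) ≤ |ε| ≤ ‖B‖·(r − 1)` and `|ε| ≤ (r − 1)⟪Bu,u⟫` with `r` the Rayleigh quotient of
the capacitance matrix `VᵀB⁻¹V` at that eigenvalue's own moment vector — word for word the one-driver
law of gen 6 (`(s − 1)λ_min ≤ |ε₁| ≤ (s − 1)‖A‖`, `|ε₁| ≤ (s − 1)⟨Au₁,u₁⟩`, file
`PfPersistenceIntruderArrival`; one driver: `r = s = vᵀA⁻¹v` for every `c`). The `k`-th negative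
eigenvalue is born where `r` at its moment vector crosses `1`, which it can only do once the `k`-th
eigenvalue of `M(a)` exceeds `1` (gen 4 index law); DATA (THEORY-INTRUDER §12.3): at the two-driver
windows the second intruder's normalised moment vector lies along the second super-critical
eigenvector of `M`. Same positivity premise `B ≥ 0` as gens 4–6 (absent for a complete split,
`PfPersistenceIntruderArrival.partialRemainder_nonneg_iff`).

Don't-look sentence (RULING A24 k4): every statement here holds for ANY symmetric window admitting
such a split; nothing in this file separates `ζ` from a control, and `ι = ∅` for `ζ` would be the
RH-shaped statement the cell does not make.

## References
* P. Arbenz, G. H. Golub, SIAM J. Matrix Anal. Appl. 9 (1988) 40–58 (block secular equation). [ArbenzGolub1988]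
* G. H. Golub, C. F. Van Loan, *Matrix Computations*, 4th ed. (2013), Thm 8.4.3. [GolubVanLoan2013]
* R. A. Horn, C. R. Johnson, *Matrix Analysis*, 2nd ed. (2013), Thm 7.7.7. [HornJohnson2013]
-/

noncomputable section

open scoped InnerProductSpace BigOperators

set_option linter.dupNamespace false

namespace Summit.RiemannHypothesis.RiemannHypothesis.Theorems.PfPersistenceIntruderArrivalRayleigh

open Literature.Analysis.InnerProduct
open Summit.RiemannHypothesis.RiemannHypothesis.Theorems.PfPersistenceIntruderOrthogonality (Intruder)
open Summit.RiemannHypothesis.RiemannHypothesis.Theorems.PfPersistenceIntruderShadowMulti (OffLineSplitN)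
open Summit.RiemannHypothesis.RiemannHypothesis.Theorems.PfPersistenceIntruderArrivalMulti
  (inner_vec_self sum_sq_moment_eq)

variable {E : Type*} [NormedAddCommGroup E] [InnerProductSpace ℝ E]
variable {ι : Type*} [Fintype ι] {T : E →ₗ[ℝ] E} (S : OffLineSplitN T ι)

/-- The moment vector of an intruder is nonzero: `0 < ∑ᵢ ⟪vᵢ,u⟫² = ⟪B u,u⟫ + |ε|` — so its Rayleigh
quotient in the capacitance matrix is well defined. [folklore] -/
theorem sum_sq_moment_pos (I : Intruder T) : 0 < ∑ i, ⟪S.v i, I.vec⟫_ℝ ^ 2 := by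
  rw [sum_sq_moment_eq S I]
  have h1 := S.B_nonneg I.vec
  have h2 : 0 < -I.eig := neg_pos.mpr I.eig_neg
  linarith

/-- **Arrival law, Rayleigh–Cauchy–Schwarz form**: `|ε| ∑ᵢ ⟪vᵢ,u⟫² ≤ Ex(c) · ⟪B u, u⟫`, i.e.
`|ε| ≤ (r − 1)⟪Bu,u⟫` with `r = cᵀMc/|c|²` the Rayleigh quotient of the capacitance matrix at the
moment vector (`‖u‖ = 1`; tree `finiteRank_downdate_eig_mul_sq_moment_le_excess_mul_form`).
[cite: ArbenzGolub1988, block secular equation] -/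
theorem negEig_mul_sq_moment_le_excess_mul_form (I : Intruder T) (z : ι → E)
    (hz : ∀ i, S.B (z i) = S.v i) :
    (-I.eig) * ∑ i, ⟪S.v i, I.vec⟫_ℝ ^ 2
      ≤ (∑ i, ∑ j, ⟪S.v i, I.vec⟫_ℝ * ⟪S.v j, I.vec⟫_ℝ * ⟪S.v i, z j⟫_ℝ
          - ∑ i, ⟪S.v i, I.vec⟫_ℝ ^ 2) * ⟪S.B I.vec, I.vec⟫_ℝ := by
  have h := finiteRank_downdate_eig_mul_sq_moment_le_excess_mul_form S.B S.B_symm S.B_nonneg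
    (S.intruder_eq I) hz
  rwa [inner_vec_self, mul_one] at h

/-- **Arrival law, upper Rayleigh form**: if `⟪B x, x⟫ ≤ Λ ⟪x, x⟫` for all `x` (`‖B‖ ≤ Λ`) then
`|ε| ∑ᵢ ⟪vᵢ,u⟫² ≤ Λ Ex(c)`, i.e. `|ε| ≤ ‖B‖ (r − 1)` (tree
`finiteRank_downdate_eig_mul_sq_moment_le_mul_excess`). [cite: GolubVanLoan2013, Thm 8.4.3] -/
theorem negEig_mul_sq_moment_le_mul_excess (I : Intruder T) (z : ι → E)
    (hz : ∀ i, S.B (z i) = S.v i) {Λ : ℝ} (hΛ : ∀ x : E, ⟪S.B x, x⟫_ℝ ≤ Λ * ⟪x, x⟫_ℝ) :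
    (-I.eig) * ∑ i, ⟪S.v i, I.vec⟫_ℝ ^ 2
      ≤ Λ * (∑ i, ∑ j, ⟪S.v i, I.vec⟫_ℝ * ⟪S.v j, I.vec⟫_ℝ * ⟪S.v i, z j⟫_ℝ
          - ∑ i, ⟪S.v i, I.vec⟫_ℝ ^ 2) :=
  finiteRank_downdate_eig_mul_sq_moment_le_mul_excess S.B S.B_symm S.B_nonneg
    (neg_pos.mpr I.eig_neg).le (PfPersistenceIntruderArrival.Intruder.vec_ne_zero I)
    (S.intruder_eq I) hz hΛ

/-- **Arrival law, coercive lower Rayleigh form**: if `0 ≤ β` and `β ⟪x, x⟫ ≤ ⟪B x, x⟫` for all `x`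
(`λ_min(B) ≥ β`) then `β Ex(c) ≤ |ε| ∑ᵢ ⟪vᵢ,u⟫²`, i.e. `λ_min(B)(r − 1) ≤ |ε|` (tree
`finiteRank_downdate_mul_excess_le_eig_mul_sq_moment`). [cite: GolubVanLoan2013, Thm 8.4.3] -/
theorem mul_excess_le_negEig_mul_sq_moment (I : Intruder T) (z : ι → E)
    (hz : ∀ i, S.B (z i) = S.v i) {β : ℝ} (hβ0 : 0 ≤ β)
    (hβ : ∀ x : E, β * ⟪x, x⟫_ℝ ≤ ⟪S.B x, x⟫_ℝ) :
    β * (∑ i, ∑ j, ⟪S.v i, I.vec⟫_ℝ * ⟪S.v j, I.vec⟫_ℝ * ⟪S.v i, z j⟫_ℝ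
          - ∑ i, ⟪S.v i, I.vec⟫_ℝ ^ 2)
      ≤ (-I.eig) * ∑ i, ⟪S.v i, I.vec⟫_ℝ ^ 2 :=
  finiteRank_downdate_mul_excess_le_eig_mul_sq_moment S.B S.B_symm (neg_pos.mpr I.eig_neg).le
    (S.intruder_eq I) hz hβ0 hβ

/-- **Two-sided Rayleigh arrival law on a split** (`β ≤ B ≤ Λ`, `0 ≤ β`):
`β Ex(c) ≤ |ε| |c|² ≤ Λ Ex(c)`, i.e. `λ_min(B)(r − 1) ≤ |ε| ≤ ‖B‖(r − 1)` for EVERY intruder — the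
`m`-driver analogue of gen 6's `(s − 1)λ_min ≤ |ε₁| ≤ (s − 1)‖A‖` (tree
`finiteRank_downdate_excess_rayleigh_two_sided`).
[cite: GolubVanLoan2013, Thm 8.4.3; ArbenzGolub1988, block secular equation] -/
theorem rayleigh_two_sided (I : Intruder T) (z : ι → E) (hz : ∀ i, S.B (z i) = S.v i)
    {β Λ : ℝ} (hβ0 : 0 ≤ β) (hβ : ∀ x : E, β * ⟪x, x⟫_ℝ ≤ ⟪S.B x, x⟫_ℝ)
    (hΛ : ∀ x : E, ⟪S.B x, x⟫_ℝ ≤ Λ * ⟪x, x⟫_ℝ) :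
    β * (∑ i, ∑ j, ⟪S.v i, I.vec⟫_ℝ * ⟪S.v j, I.vec⟫_ℝ * ⟪S.v i, z j⟫_ℝ
          - ∑ i, ⟪S.v i, I.vec⟫_ℝ ^ 2)
        ≤ (-I.eig) * ∑ i, ⟪S.v i, I.vec⟫_ℝ ^ 2 ∧
      (-I.eig) * ∑ i, ⟪S.v i, I.vec⟫_ℝ ^ 2
        ≤ Λ * (∑ i, ∑ j, ⟪S.v i, I.vec⟫_ℝ * ⟪S.v j, I.vec⟫_ℝ * ⟪S.v i, z j⟫_ℝ
          - ∑ i, ⟪S.v i, I.vec⟫_ℝ ^ 2) :=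
  ⟨mul_excess_le_negEig_mul_sq_moment S I z hz hβ0 hβ,
    negEig_mul_sq_moment_le_mul_excess S I z hz hΛ⟩

end Summit.RiemannHypothesis.RiemannHypothesis.Theorems.PfPersistenceIntruderArrivalRayleigh
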